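import Summits.Ventures.DiscreteObjects.Verify.DesignsKernel

/-!
# Kernel replay of the (+) control M-pair10 (cell pub-namedobj, designs seat)
Framing: lottery ticket; floor = certified bounds/negative ranges.
A pair of orthogonal Latin squares of order 10 re-derived by the census pipeline (mate10.py, seed
20260820: random Latin square + exact cover of its cells by 10 disjoint transversals), checked here by
the kernel with verify-ref's `isMOLS`. Reproduces the existence statement N(10) ≥ 2 (Parker 1959;
Bose–Shrikhande–Parker 1960) on an explicit object; not a new result.
-/

namespace Summit.Ventures.DiscreteObjects.Verify

/-- the order-10 Latin square found by mate10.py (seed 20260820) -/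
def pair10L : List (List Nat) := [[0, 1, 6, 9, 2, 5, 3, 7, 8, 4], [9, 8, 7, 3, 1, 0, 2, 5, 4, 6], [3, 4, 9, 5, 8, 7, 6, 1, 0, 2], [8, 0, 1, 7, 5, 9, 4, 6, 2, 3], [6, 2, 0, 1, 9, 4, 5, 8, 3, 7], [5, 7, 2, 4, 6, 3, 1, 0, 9, 8], [4, 6, 5, 8, 7, 2, 0, 3, 1, 9], [1, 9, 3, 0, 4, 8, 7, 2, 6, 5], [7, 3, 4, 2, 0, 6, 8, 9, 5, 1], [2, 5, 8, 6, 3, 1, 9, 4, 7, 0]]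

/-- its orthogonal mate (10 disjoint transversals found by exact cover) -/
def pair10M : List (List Nat) := [[5, 1, 6, 4, 7, 8, 0, 2, 9, 3], [3, 8, 7, 9, 5, 6, 2, 4, 0, 1], [6, 7, 5, 1, 2, 0, 3, 9, 4, 8], [1, 2, 3, 8, 6, 9, 4, 0, 5, 7], [2, 6, 8, 0, 1, 5, 9, 7, 3, 4], [7, 5, 9, 2, 4, 1, 8, 3, 6, 0], [8, 9, 0, 6, 3, 4, 1, 5, 7, 2], [4, 0, 2, 7, 9, 3, 6, 1, 8, 5], [9, 4, 1, 3, 0, 7, 5, 8, 2, 6], [0, 3, 4, 5, 8, 2, 7, 6, 1, 9]]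

/-- control M-pair10: the two squares are Latin and orthogonal (kernel `decide`). -/
theorem pair10_isMOLS : isMOLS [pair10L, pair10M] = true := by
  decide

end Summit.Ventures.DiscreteObjects.Verify
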